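import Summits.QuantumFields.YangMills.Theorems.LuscherReductionOneSiteLevelsKacFlatten

/-!
# INNER, layer II (flattening, part 2): the one-site jump form through the gnomonic chart —
# `latticeJump (2/t³) g ≥ 8ρ₀ · t · (1 − 6μ²R²)² · flatJumpBall t R G`

Support module of crux `OneSiteLevels` (route `LuscherReduction`, item stmt-QuantumFields-20007; STUB-PLAN
`Cruxes/OneSiteLevels/STUB-PLAN-stub_absUpperInnerAL1.md` §2.2 item II.4 (lattice half, kinetic term), owner ruling INNER-RULING-g16),
fleet seat ym-luscher-20007-p2 (LATTICE lane).  Everything here is proved, AL1-free.  Setting as in part 1 (`…KacFlatten`):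
`t > 0`, `B = 2/t³`, `μ = t/2`, `ρ₀ = μ⁹(2π²)⁻³`, `g` chart-represented by `G`.

* `latticeJump_eq_prod`, `integral_cfgProd_eq_sum_gnChart`, `latticeJump_eq_sum`: the lattice jump form as the sum of the `64` chart
  pair terms `jumpPairTerm B μ G (σ,σ′) = ∫ ρ(y)ρ(y′) E_B(gnChart σ y, gnChart σ′ y′)(G y − G y′)²` (product change of variables
  `configMeasure_prod_eq_sum`).
* `eight_mul_diag_le_sum`: cross-pattern pairs DROPPED — every pair term is `≥ 0` and the eight diagonal ones agree (jump forms are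
  monotone in the kernel: the point of the currency).
* `exp_le_linkE_gnChart_same`, `jumpIntegrand_ge`, `diag_ge_flatJumpBall`: same-pattern minorant `E_B ≥ e^{6B} e^{−Bμ²‖y−y′‖²}`
  (`timeCoupling_gnChart_same`, `sum_gnDefect_nonneg`) and the density minorant `ρ ≥ ρ₀(1 − 6μ²R²)` on the ball pair.
* **`latticeJump_ge_flatJumpBall`**: `8ρ₀ · t · (1 − 6μ²R²)² · flatJumpBall t R G ≤ latticeJump (2/t³) g` — with the sharp normaliser
  `linkC_pow_three_le_gauss` the Gaussian constants cancel exactly (`μ√(2πt) = √(π/B)`).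

## WHAT THIS IS NOT
Not the INNER stub (Gaussian tail + assembly are the companion files).  Femto rung R2b1 vocabulary; NOT an infinite-volume ∕ Clay
gap statement.
-/

set_option autoImplicit false

noncomputable section

open MeasureTheory Filter Topology Real
open scoped ENNReal
open Literature.MathematicalPhysics.QuantumFieldTheory
open Literature.MathematicalPhysics.QuantumLattice
open Literature.Analysis.OperatorTheory.YMMatrixModel

namespace Summit.QuantumFields.YangMills.Theorems.FemtoTransferGap

/-! ### §4. The jump form through the chart (II.4, kinetic half) -/

section Jump

variable {μ B : ℝ}

/-- `latticeJump` as a product integral. [folklore] -/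
theorem latticeJump_eq_prod {B : ℝ} (hB : 0 ≤ B) {g : Cfg → ℝ} (hgm : Measurable g) {C : ℝ} (hgb : ∀ U, |g U| ≤ C) :
    latticeJump B g = (1 / 2 : ℝ) *
      (∫ p, linkE B p.1 p.2 * (g p.1 - g p.2) ^ 2 ∂(cfgMeasure.prod cfgMeasure)) / linkCE B := by
  have hI : Integrable (fun p : Cfg × Cfg => linkE B p.1 p.2 * (g p.1 - g p.2) ^ 2) (cfgMeasure.prod cfgMeasure) := by
    refine integrable_cfgProd ((measurable_linkE B).mul (((hgm.comp measurable_fst).sub (hgm.comp measurable_snd)).pow_const 2))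
      (C := Real.exp (2 * B) ^ Fintype.card (Edge 3 1) * (2 * C) ^ 2) fun p => ?_
    rw [abs_mul, abs_pow]
    refine mul_le_mul (abs_linkE_le hB _ _) (pow_le_pow_left₀ (abs_nonneg _) ?_ 2) (by positivity) (by positivity)
    calc |g p.1 - g p.2| ≤ |g p.1| + |g p.2| := abs_sub _ _
      _ ≤ C + C := add_le_add (hgb _) (hgb _)
      _ = 2 * C := by ring
  unfold latticeJump
  rw [integral_prod _ hI]

/-- **Product change of variables**: `∫ F d(σ⊗σ) = Σ_{σ,σ′} ∫ ρ(y)ρ(y′) F(gnChart σ y, gnChart σ′ y′) d(y,y′)` for an integrable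
measurable `F` on `Cfg × Cfg`. [folklore] -/
theorem integral_cfgProd_eq_sum_gnChart (hμ : 0 < μ) {F : Cfg × Cfg → ℝ} (hFm : Measurable F)
    (hFi : Integrable F (cfgMeasure.prod cfgMeasure)) :
    ∫ p, F p ∂(cfgMeasure.prod cfgMeasure) = ∑ σσ' : (Fin 3 → Bool) × (Fin 3 → Bool),
      ∫ q : ZM × ZM, gnDensityReal μ q.1 * gnDensityReal μ q.2 * F (gnChart μ σσ'.1 q.1, gnChart μ σσ'.2 q.2)
        ∂((volume : Measure ZM).prod volume) := by
  rw [show cfgMeasure.prod cfgMeasure = (configMeasure SU2 1).prod (configMeasure SU2 1) from rfl] at hFi ⊢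
  rw [configMeasure_prod_eq_sum hμ] at hFi ⊢
  rw [integral_sum_measure hFi, tsum_fintype]
  refine Finset.sum_congr rfl fun σσ' _ => ?_
  rw [integral_map (measurable_gnPairChart μ σσ').aemeasurable hFm.aestronglyMeasurable,
    integral_withDensity_eq_integral_toReal_smul (measurable_gnDensity₂ μ)
      (ae_of_all _ fun q => by unfold gnDensity₂; rw [gnDensity_eq, gnDensity_eq]; exact ENNReal.mul_lt_top ENNReal.ofReal_lt_top ENNReal.ofReal_lt_top)]
  refine integral_congr_ae (ae_of_all _ fun q => ?_)
  show (gnDensity₂ μ q).toReal • F (gnPairChart μ σσ' q) = _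
  rw [gnDensity₂, gnDensity_eq, gnDensity_eq, ENNReal.toReal_mul, ENNReal.toReal_ofReal (gnDensityReal_pos hμ _).le,
    ENNReal.toReal_ofReal (gnDensityReal_pos hμ _).le, smul_eq_mul]
  rfl

/-- The chart jump pair term `J_{σσ′} = ∫ ρ(y)ρ(y′) E_B(gnChart σ y, gnChart σ′ y′) (G y − G y′)² d(y,y′)`. [folklore] -/
def jumpPairTerm (B μ : ℝ) (G : ZM → ℝ) (σσ' : (Fin 3 → Bool) × (Fin 3 → Bool)) : ℝ :=
  ∫ q : ZM × ZM, gnDensityReal μ q.1 * gnDensityReal μ q.2 *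
    (linkE B (gnChart μ σσ'.1 q.1) (gnChart μ σσ'.2 q.2) * (G q.1 - G q.2) ^ 2) ∂((volume : Measure ZM).prod volume)

/-- Every chart jump pair term is nonnegative (`μ > 0`). [folklore] -/
theorem jumpPairTerm_nonneg (hμ : 0 < μ) (B : ℝ) (G : ZM → ℝ) (σσ' : (Fin 3 → Bool) × (Fin 3 → Bool)) :
    0 ≤ jumpPairTerm B μ G σσ' := by
  unfold jumpPairTerm
  refine integral_nonneg fun q => ?_
  have h1 := (gnDensityReal_pos hμ q.1).le; have h2 := (gnDensityReal_pos hμ q.2).le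
  have h3 := (linkE_pos B (gnChart μ σσ'.1 q.1) (gnChart μ σσ'.2 q.2)).le
  positivity

/-- The electric kernel at two chart points of the SAME pattern: `E_B = exp(B(6 − μ²‖y−y′‖² + Σ_i d_i))`, pattern independent.
[folklore] -/
theorem linkE_gnChart_same (B μ : ℝ) (σ : Fin 3 → Bool) (y y' : ZM) :
    linkE B (gnChart μ σ y) (gnChart μ σ y') =
      Real.exp (B * (6 - μ ^ 2 * ‖y - y'‖ ^ 2 + ∑ i : Fin 3, gnDefect (fun a => μ * y (i, a)) (fun a => μ * y' (i, a)))) := by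
  rw [linkE_eq_exp, timeCoupling_gnChart_same]

/-- **Same-pattern minorant**: `E_B(gnChart σ y, gnChart σ y′) ≥ e^{6B} e^{−Bμ²‖y−y′‖²}` for `B ≥ 0` (the defect is `≥ 0`). [folklore] -/
theorem exp_le_linkE_gnChart_same (hB : 0 ≤ B) (μ : ℝ) (σ : Fin 3 → Bool) (y y' : ZM) :
    Real.exp (6 * B) * Real.exp (-(B * μ ^ 2 * ‖y - y'‖ ^ 2)) ≤ linkE B (gnChart μ σ y) (gnChart μ σ y') := by
  rw [linkE_gnChart_same, ← Real.exp_add]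
  refine Real.exp_le_exp.2 ?_
  have hd := sum_gnDefect_nonneg μ y y'
  nlinarith

/-- All diagonal chart jump pair terms coincide. [folklore] -/
theorem jumpPairTerm_diag_eq (B μ : ℝ) (G : ZM → ℝ) (σ σ₀ : Fin 3 → Bool) :
    jumpPairTerm B μ G (σ, σ) = jumpPairTerm B μ G (σ₀, σ₀) := by
  unfold jumpPairTerm
  refine integral_congr_ae (ae_of_all _ fun q => ?_)
  simp only
  rw [linkE_gnChart_same, linkE_gnChart_same]

/-- **The lattice jump form is the sum of the `64` chart pair terms** (for `B ≥ 0`, `μ > 0`, bounded measurable `g` chart-represented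
by `G`). [folklore] -/
theorem latticeJump_eq_sum (hμ : 0 < μ) (hB : 0 ≤ B) {g : Cfg → ℝ} (hgm : Measurable g) {C : ℝ} (hgb : ∀ U, |g U| ≤ C)
    {G : ZM → ℝ} (hrep : ∀ σ y, g (gnChart μ σ y) = G y) :
    latticeJump B g = (1 / 2 : ℝ) * (∑ σσ' : (Fin 3 → Bool) × (Fin 3 → Bool), jumpPairTerm B μ G σσ') / linkCE B := by
  have hFm : Measurable fun p : Cfg × Cfg => linkE B p.1 p.2 * (g p.1 - g p.2) ^ 2 :=
    (measurable_linkE B).mul (((hgm.comp measurable_fst).sub (hgm.comp measurable_snd)).pow_const 2)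
  have hFi : Integrable (fun p : Cfg × Cfg => linkE B p.1 p.2 * (g p.1 - g p.2) ^ 2) (cfgMeasure.prod cfgMeasure) := by
    refine integrable_cfgProd hFm (C := Real.exp (2 * B) ^ Fintype.card (Edge 3 1) * (2 * C) ^ 2) fun p => ?_
    rw [abs_mul, abs_pow]
    refine mul_le_mul (abs_linkE_le hB _ _) (pow_le_pow_left₀ (abs_nonneg _) ?_ 2) (by positivity) (by positivity)
    calc |g p.1 - g p.2| ≤ |g p.1| + |g p.2| := abs_sub _ _
      _ ≤ C + C := add_le_add (hgb _) (hgb _)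
      _ = 2 * C := by ring
  rw [latticeJump_eq_prod hB hgm hgb, integral_cfgProd_eq_sum_gnChart hμ hFm hFi]
  congr 2
  refine Finset.sum_congr rfl fun σσ' _ => ?_
  unfold jumpPairTerm
  refine integral_congr_ae (ae_of_all _ fun q => ?_)
  simp only [hrep]

/-- **Dropping the cross-pattern pairs**: `Σ_{σσ′} J_{σσ′} ≥ 8 · J_{σ₀σ₀}` (all terms nonnegative, the `8` diagonal ones equal).
[folklore] -/
theorem eight_mul_diag_le_sum (hμ : 0 < μ) (B : ℝ) (G : ZM → ℝ) (σ₀ : Fin 3 → Bool) :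
    8 * jumpPairTerm B μ G (σ₀, σ₀) ≤ ∑ σσ' : (Fin 3 → Bool) × (Fin 3 → Bool), jumpPairTerm B μ G σσ' := by
  rw [Fintype.sum_prod_type]
  have hcard : Fintype.card (Fin 3 → Bool) = 8 := by simp
  have hdiag : ∀ σ : Fin 3 → Bool, jumpPairTerm B μ G (σ₀, σ₀) ≤ ∑ σ', jumpPairTerm B μ G (σ, σ') := fun σ => by
    rw [← jumpPairTerm_diag_eq B μ G σ σ₀]
    exact Finset.single_le_sum (fun σ' _ => jumpPairTerm_nonneg hμ B G (σ, σ')) (Finset.mem_univ σ)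
  have h := Finset.sum_le_sum fun σ (_ : σ ∈ (Finset.univ : Finset (Fin 3 → Bool))) => hdiag σ
  rw [Finset.sum_const, Finset.card_univ, hcard, nsmul_eq_mul] at h
  exact_mod_cast h

/-- A bounded measurable function on `ZM × ZM` vanishing off a ball pair is integrable. [folklore] -/
theorem integrable_prod_of_bounded_of_support {H : ZM × ZM → ℝ} (hH : Measurable H) {M : ℝ} (hM : ∀ q, |H q| ≤ M) {R : ℝ}
    (hsupp : ∀ q, H q ≠ 0 → ‖q.1‖ ≤ R ∧ ‖q.2‖ ≤ R) :
    Integrable H ((volume : Measure ZM).prod volume) := by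
  set K : Set (ZM × ZM) := Metric.closedBall (0 : ZM) R ×ˢ Metric.closedBall (0 : ZM) R with hK
  have hKm : MeasurableSet K :=
    Metric.isClosed_closedBall.measurableSet.prod Metric.isClosed_closedBall.measurableSet
  have hKfin : ((volume : Measure ZM).prod volume) K ≠ ∞ := by
    rw [hK, Measure.prod_prod]
    exact ENNReal.mul_ne_top measure_closedBall_lt_top.ne measure_closedBall_lt_top.ne
  have hHi : H = K.indicator H := by
    funext q
    by_cases hq : q ∈ K
    · rw [Set.indicator_of_mem hq]
    · rw [Set.indicator_of_notMem hq]
      by_contra h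
      obtain ⟨h1, h2⟩ := hsupp q h
      exact hq ⟨by rw [Metric.mem_closedBall, dist_zero_right]; exact h1, by rw [Metric.mem_closedBall, dist_zero_right]; exact h2⟩
  rw [hHi, integrable_indicator_iff hKm]
  exact Measure.integrableOn_of_bounded (M := M) hKfin hH.aestronglyMeasurable
    (ae_of_all _ fun q => by rw [Real.norm_eq_abs]; exact hM q)

/-- The integrand of `flatJumpBall` is integrable on `ZM × ZM` for bounded measurable `G` (`t > 0`). [folklore] -/
theorem integrable_flatJumpBall_integrand {t : ℝ} (ht : 0 < t) {G : ZM → ℝ} (hGm : Measurable G) {M : ℝ}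
    (hGb : ∀ y, |G y| ≤ M) (R : ℝ) :
    Integrable (fun q : ZM × ZM => ballInd R q.1 * ballInd R q.2 * (heatKernel t q.1 q.2 * (G q.1 - G q.2) ^ 2))
      ((volume : Measure ZM).prod volume) := by
  have hS9pos : 0 < Real.sqrt (2 * π * t) ^ 9 := by positivity
  have hGGm : Measurable fun q : ZM × ZM => (G q.1 - G q.2) ^ 2 :=
    ((hGm.comp measurable_fst).sub (hGm.comp measurable_snd)).pow_const 2
  have hGG : ∀ q : ZM × ZM, |(G q.1 - G q.2) ^ 2| ≤ (2 * M) ^ 2 := fun q => by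
    rw [abs_pow]
    refine pow_le_pow_left₀ (abs_nonneg _) ?_ 2
    calc |G q.1 - G q.2| ≤ |G q.1| + |G q.2| := abs_sub _ _
      _ ≤ M + M := add_le_add (hGb _) (hGb _)
      _ = 2 * M := by ring
  have hKm : Measurable fun q : ZM × ZM => heatKernel t q.1 q.2 := by
    unfold heatKernel
    exact measurable_const.mul (Real.measurable_exp.comp (((measurable_fst.sub measurable_snd).norm.pow_const 2).neg.div_const _))
  have hFm : Measurable (fun q : ZM × ZM => ballInd R q.1 * ballInd R q.2 * (heatKernel t q.1 q.2 * (G q.1 - G q.2) ^ 2)) :=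
    (((measurable_ballInd R).comp measurable_fst).mul ((measurable_ballInd R).comp measurable_snd)).mul (hKm.mul hGGm)
  refine integrable_prod_of_bounded_of_support hFm (M := (Real.sqrt (2 * π * t) ^ 9)⁻¹ * (2 * M) ^ 2) (R := R)
    (fun q => ?_) (fun q hq => ?_)
  · rw [abs_mul, abs_mul, abs_mul, abs_of_nonneg (ballInd_nonneg R q.1), abs_of_nonneg (ballInd_nonneg R q.2),
      abs_of_nonneg (heatKernel_nonneg ht q.1 q.2)]
    have hk : heatKernel t q.1 q.2 ≤ (Real.sqrt (2 * π * t) ^ 9)⁻¹ := by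
      rw [heatKernel_eq ht]
      refine mul_le_of_le_one_right (by positivity) (Real.exp_le_one_iff.2 ?_)
      exact div_nonpos_of_nonpos_of_nonneg (neg_nonpos.2 (sq_nonneg _)) (by positivity)
    calc ballInd R q.1 * ballInd R q.2 * (heatKernel t q.1 q.2 * |(G q.1 - G q.2) ^ 2|)
        ≤ 1 * 1 * ((Real.sqrt (2 * π * t) ^ 9)⁻¹ * (2 * M) ^ 2) := by
          refine mul_le_mul (mul_le_mul (ballInd_le_one R q.1) (ballInd_le_one R q.2) (ballInd_nonneg R q.2) zero_le_one)
            (mul_le_mul hk (hGG q) (abs_nonneg _) (by positivity))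
            (mul_nonneg (heatKernel_nonneg ht _ _) (abs_nonneg _)) (by positivity)
      _ = (Real.sqrt (2 * π * t) ^ 9)⁻¹ * (2 * M) ^ 2 := by ring
  · constructor
    · by_contra h1; apply hq; simp only [ballInd, if_neg h1]; ring
    · by_contra h2; apply hq; simp only [ballInd, if_neg h2]; ring

/-- The integrand of a chart jump pair term is integrable on `ZM × ZM` (`B ≥ 0`, `μ > 0`, bounded measurable `G`). [folklore] -/
theorem integrable_jumpPairTerm_integrand (hμ : 0 < μ) (hB : 0 ≤ B) {G : ZM → ℝ} (hGm : Measurable G) {M : ℝ}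
    (hGb : ∀ y, |G y| ≤ M) (σ σ' : Fin 3 → Bool) :
    Integrable (fun q : ZM × ZM => gnDensityReal μ q.1 * gnDensityReal μ q.2 *
      (linkE B (gnChart μ σ q.1) (gnChart μ σ' q.2) * (G q.1 - G q.2) ^ 2)) ((volume : Measure ZM).prod volume) := by
  have hρi := integrable_gnDensityReal hμ
  have hGGm : Measurable fun q : ZM × ZM => (G q.1 - G q.2) ^ 2 :=
    ((hGm.comp measurable_fst).sub (hGm.comp measurable_snd)).pow_const 2
  have hGG : ∀ q : ZM × ZM, |(G q.1 - G q.2) ^ 2| ≤ (2 * M) ^ 2 := fun q => by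
    rw [abs_pow]
    refine pow_le_pow_left₀ (abs_nonneg _) ?_ 2
    calc |G q.1 - G q.2| ≤ |G q.1| + |G q.2| := abs_sub _ _
      _ ≤ M + M := add_le_add (hGb _) (hGb _)
      _ = 2 * M := by ring
  haveI := secondCountableTopology_su2
  have hEm' : Measurable ((fun p : Cfg × Cfg => linkE B p.1 p.2) ∘ gnPairChart μ (σ, σ')) :=
    (measurable_linkE B).comp (measurable_gnPairChart μ (σ, σ'))
  have hEm : Measurable fun q : ZM × ZM => linkE B (gnChart μ σ q.1) (gnChart μ σ' q.2) := by
    simpa only [Function.comp_def, gnPairChart, Prod.map_fst, Prod.map_snd] using hEm'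
  have hdom : Integrable (fun q : ZM × ZM => gnDensityReal μ q.1 * gnDensityReal μ q.2 *
      (Real.exp (2 * B) ^ Fintype.card (Edge 3 1) * (2 * M) ^ 2)) ((volume : Measure ZM).prod volume) :=
    (hρi.mul_prod hρi).mul_const _
  refine hdom.mono' ?_ (ae_of_all _ fun q => ?_)
  · exact ((((measurable_gnDensityReal μ).comp measurable_fst).mul ((measurable_gnDensityReal μ).comp measurable_snd)).mul
      (hEm.mul hGGm)).aestronglyMeasurable
  · rw [Real.norm_eq_abs, abs_mul, abs_of_nonneg (mul_nonneg (gnDensityReal_pos hμ q.1).le (gnDensityReal_pos hμ q.2).le),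
      abs_mul]
    exact mul_le_mul_of_nonneg_left (mul_le_mul (abs_linkE_le hB _ _) (hGG q) (abs_nonneg _) (by positivity))
      (mul_nonneg (gnDensityReal_pos hμ q.1).le (gnDensityReal_pos hμ q.2).le)

/-- **Pointwise minorant** behind the diagonal bound: with `Bμ² = 1/(2t)` and `6μ²R² ≤ 1`,
`(ρ₀(1−6μ²R²))² e^{6B} √(2πt)⁹ · [1_B 1_B p_t (G−G′)²] ≤ ρ(y)ρ(y′) E_B(chart y, chart y′) (G y − G y′)²`. [folklore] -/
theorem jumpIntegrand_ge {t : ℝ} (ht : 0 < t) (hμ : 0 < μ) (hB : 0 ≤ B) (hBμ : B * μ ^ 2 = 1 / (2 * t))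
    (G : ZM → ℝ) {R : ℝ} (hR6 : 6 * (μ ^ 2 * R ^ 2) ≤ 1) (σ : Fin 3 → Bool) (q : ZM × ZM) :
    (μ ^ 9 * ((2 * π ^ 2)⁻¹) ^ 3 * (1 - 6 * (μ ^ 2 * R ^ 2))) ^ 2 * Real.exp (6 * B) * Real.sqrt (2 * π * t) ^ 9 *
        (ballInd R q.1 * ballInd R q.2 * (heatKernel t q.1 q.2 * (G q.1 - G q.2) ^ 2)) ≤
      gnDensityReal μ q.1 * gnDensityReal μ q.2 * (linkE B (gnChart μ σ q.1) (gnChart μ σ q.2) * (G q.1 - G q.2) ^ 2) := by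
  have hρmin0 : 0 ≤ μ ^ 9 * ((2 * π ^ 2)⁻¹) ^ 3 * (1 - 6 * (μ ^ 2 * R ^ 2)) := mul_nonneg (by positivity) (by linarith)
  have hS9pos : 0 < Real.sqrt (2 * π * t) ^ 9 := by positivity
  have hL0 : 0 ≤ gnDensityReal μ q.1 * gnDensityReal μ q.2 *
      (linkE B (gnChart μ σ q.1) (gnChart μ σ q.2) * (G q.1 - G q.2) ^ 2) := by
    have h1 := (gnDensityReal_pos hμ q.1).le; have h2 := (gnDensityReal_pos hμ q.2).le
    have h3 := (linkE_pos B (gnChart μ σ q.1) (gnChart μ σ q.2)).le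
    positivity
  by_cases hq1 : ‖q.1‖ ≤ R
  · by_cases hq2 : ‖q.2‖ ≤ R
    · have hρ1 := gnDensityReal_ge_of_norm_le hμ hq1
      have hρ2 := gnDensityReal_ge_of_norm_le hμ hq2
      have hE := exp_le_linkE_gnChart_same hB μ σ q.1 q.2
      have hker : Real.sqrt (2 * π * t) ^ 9 * heatKernel t q.1 q.2 = Real.exp (-(B * μ ^ 2 * ‖q.1 - q.2‖ ^ 2)) := by
        rw [heatKernel_eq ht, ← mul_assoc, mul_inv_cancel₀ hS9pos.ne', one_mul, hBμ]
        congr 1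
        field_simp
      simp only [ballInd, if_pos hq1, if_pos hq2, one_mul]
      have hsq := sq_nonneg (G q.1 - G q.2)
      calc (μ ^ 9 * ((2 * π ^ 2)⁻¹) ^ 3 * (1 - 6 * (μ ^ 2 * R ^ 2))) ^ 2 * Real.exp (6 * B) * Real.sqrt (2 * π * t) ^ 9 *
            (heatKernel t q.1 q.2 * (G q.1 - G q.2) ^ 2)
          = (μ ^ 9 * ((2 * π ^ 2)⁻¹) ^ 3 * (1 - 6 * (μ ^ 2 * R ^ 2))) * (μ ^ 9 * ((2 * π ^ 2)⁻¹) ^ 3 * (1 - 6 * (μ ^ 2 * R ^ 2))) *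
            ((Real.exp (6 * B) * (Real.sqrt (2 * π * t) ^ 9 * heatKernel t q.1 q.2)) * (G q.1 - G q.2) ^ 2) := by ring
        _ ≤ gnDensityReal μ q.1 * gnDensityReal μ q.2 * (linkE B (gnChart μ σ q.1) (gnChart μ σ q.2) * (G q.1 - G q.2) ^ 2) := by
            rw [hker]
            exact mul_le_mul (mul_le_mul hρ1 hρ2 hρmin0 (gnDensityReal_pos hμ q.1).le) (mul_le_mul_of_nonneg_right hE hsq)
              (by positivity) (mul_nonneg (gnDensityReal_pos hμ q.1).le (gnDensityReal_pos hμ q.2).le)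
    · simp only [ballInd, if_neg hq2, mul_zero, zero_mul]
      exact hL0
  · simp only [ballInd, if_neg hq1, zero_mul, mul_zero]
    exact hL0

/-- **The diagonal term dominates the restricted flat jump form**: for `B ≥ 0`, `μ > 0` with `Bμ² = 1/(2t)`, `t > 0`, `G` bounded
measurable, and `6μ²R² ≤ 1`,
`(ρ₀(1 − 6μ²R²))² · e^{6B} · √(2πt)⁹ · (2t) · flatJumpBall t R G ≤ J_{σσ}`. [folklore] -/
theorem diag_ge_flatJumpBall {t : ℝ} (ht : 0 < t) (hμ : 0 < μ) (hB : 0 ≤ B) (hBμ : B * μ ^ 2 = 1 / (2 * t))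
    {G : ZM → ℝ} (hGm : Measurable G) {M : ℝ} (hGb : ∀ y, |G y| ≤ M) {R : ℝ} (hR6 : 6 * (μ ^ 2 * R ^ 2) ≤ 1)
    (σ : Fin 3 → Bool) :
    (μ ^ 9 * ((2 * π ^ 2)⁻¹) ^ 3 * (1 - 6 * (μ ^ 2 * R ^ 2))) ^ 2 * Real.exp (6 * B) * Real.sqrt (2 * π * t) ^ 9 * (2 * t) *
        flatJumpBall t R G ≤ jumpPairTerm B μ G (σ, σ) := by
  have hmono := integral_mono ((integrable_flatJumpBall_integrand ht hGm hGb R).const_mul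
    ((μ ^ 9 * ((2 * π ^ 2)⁻¹) ^ 3 * (1 - 6 * (μ ^ 2 * R ^ 2))) ^ 2 * Real.exp (6 * B) * Real.sqrt (2 * π * t) ^ 9))
    (integrable_jumpPairTerm_integrand hμ hB hGm hGb σ σ) (fun q => jumpIntegrand_ge ht hμ hB hBμ G hR6 σ q)
  rw [integral_const_mul] at hmono
  unfold flatJumpBall jumpPairTerm
  have e : (μ ^ 9 * ((2 * π ^ 2)⁻¹) ^ 3 * (1 - 6 * (μ ^ 2 * R ^ 2))) ^ 2 * Real.exp (6 * B) * Real.sqrt (2 * π * t) ^ 9 * (2 * t) *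
      (1 / (2 * t) * ∫ q : ZM × ZM, ballInd R q.1 * ballInd R q.2 * (heatKernel t q.1 q.2 * (G q.1 - G q.2) ^ 2)
        ∂((volume : Measure ZM).prod volume)) =
      (μ ^ 9 * ((2 * π ^ 2)⁻¹) ^ 3 * (1 - 6 * (μ ^ 2 * R ^ 2))) ^ 2 * Real.exp (6 * B) * Real.sqrt (2 * π * t) ^ 9 *
        ∫ q : ZM × ZM, ballInd R q.1 * ballInd R q.2 * (heatKernel t q.1 q.2 * (G q.1 - G q.2) ^ 2)
          ∂((volume : Measure ZM).prod volume) := by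
    field_simp
  rw [e]
  exact hmono

/-- **II.4, kinetic half — `latticeJump B g ≥ 8 ρ₀ · t · (1 − 6μ²R²)² · flatJumpBall t R G`** at `μ = t/2`, `B = 2/t³`, for a bounded
measurable `g` chart-represented by a bounded measurable `G` and any `R` with `6μ²R² ≤ 1`.  Cross-pattern pairs and the gnomonic defect
are dropped by positivity; the Gaussian constants of the heat kernel, of the density and of the sharp normaliser cancel exactly
(`μ√(2πt) = √(π/B)`). [cite: LiebYau1988, (2.9)–(2.11)] [cite: Luscher1983, §3] -/
theorem latticeJump_ge_flatJumpBall {t : ℝ} (ht : 0 < t) {g : Cfg → ℝ} (hgm : Measurable g) {C : ℝ} (hgb : ∀ U, |g U| ≤ C)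
    {G : ZM → ℝ} (hGm : Measurable G) {M : ℝ} (hGb : ∀ y, |G y| ≤ M) (hrep : ∀ σ y, g (gnChart (t / 2) σ y) = G y)
    {R : ℝ} (hR6 : 6 * ((t / 2) ^ 2 * R ^ 2) ≤ 1) :
    8 * ((t / 2) ^ 9 * ((2 * π ^ 2)⁻¹) ^ 3) * t * (1 - 6 * ((t / 2) ^ 2 * R ^ 2)) ^ 2 * flatJumpBall t R G ≤
      latticeJump (2 / t ^ 3) g := by
  set μ : ℝ := t / 2 with hμdef
  set B : ℝ := 2 / t ^ 3 with hBdef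
  have hμ : 0 < μ := by positivity
  have hB : 0 < B := by positivity
  have hBμ : B * μ ^ 2 = 1 / (2 * t) := coupling_mul_sq_half ht
  have hπ := Real.pi_pos
  -- step 1: the chart sum and the diagonal
  rw [latticeJump_eq_sum hμ hB.le hgm hgb hrep]
  have hdiag := eight_mul_diag_le_sum hμ B G (fun _ => false)
  have hD := diag_ge_flatJumpBall ht hμ hB.le hBμ hGm hGb hR6 (fun _ => false)
  have hFJB := flatJumpBall_nonneg ht R G
  -- step 2: the normaliser
  have hCE : linkCE B ≤ Real.exp (6 * B) * Real.sqrt (π / B) ^ 9 / (2 * π ^ 2) ^ 3 := by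
    rw [linkCE, card_edge_one]; exact linkC_pow_three_le_gauss hB
  have hCEpos : 0 < linkCE B := linkCE_pos hB.le
  -- step 3: constants
  set ρ₀ : ℝ := μ ^ 9 * ((2 * π ^ 2)⁻¹) ^ 3 with hρ₀
  set a : ℝ := μ ^ 2 * R ^ 2 with ha
  set S9 : ℝ := Real.sqrt (2 * π * t) ^ 9 with hS9
  have hS9 : S9 = Real.sqrt (π / B) ^ 9 / μ ^ 9 := by
    rw [← div_pow, hBdef, ← half_mul_sqrt_eq ht, ← hμdef, mul_div_cancel_left₀ _ hμ.ne']
  have hsq : 0 < Real.sqrt (π / B) ^ 9 := by positivity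
  -- numerator lower bound
  have hnum : 8 * ((ρ₀ * (1 - 6 * a)) ^ 2 * Real.exp (6 * B) * S9 * (2 * t) * flatJumpBall t R G) ≤
      ∑ σσ' : (Fin 3 → Bool) × (Fin 3 → Bool), jumpPairTerm B μ G σσ' := le_trans (by linarith [hD]) hdiag
  have hnum0 : 0 ≤ 8 * ((ρ₀ * (1 - 6 * a)) ^ 2 * Real.exp (6 * B) * S9 * (2 * t) * flatJumpBall t R G) := by positivity
  calc 8 * ρ₀ * t * (1 - 6 * a) ^ 2 * flatJumpBall t R G
      = (1 / 2 : ℝ) * (8 * ((ρ₀ * (1 - 6 * a)) ^ 2 * Real.exp (6 * B) * S9 * (2 * t) * flatJumpBall t R G)) /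
          (Real.exp (6 * B) * Real.sqrt (π / B) ^ 9 / (2 * π ^ 2) ^ 3) := by
        rw [hS9, hρ₀]
        field_simp
    _ ≤ (1 / 2 : ℝ) * (8 * ((ρ₀ * (1 - 6 * a)) ^ 2 * Real.exp (6 * B) * S9 * (2 * t) * flatJumpBall t R G)) / linkCE B :=
        div_le_div_of_nonneg_left (by positivity) hCEpos hCE
    _ ≤ (1 / 2 : ℝ) * (∑ σσ' : (Fin 3 → Bool) × (Fin 3 → Bool), jumpPairTerm B μ G σσ') / linkCE B :=
        div_le_div_of_nonneg_right (by linarith) hCEpos.le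

end Jump

end Summit.QuantumFields.YangMills.Theorems.FemtoTransferGap

end
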